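import Mathlib.Analysis.SpecialFunctions.Trigonometric.Cotangent
import Mathlib.Analysis.Calculus.SmoothSeries
import HarnessLib

/-!
# The partial fraction expansion of `1/sin²`: `Σ_{n∈ℤ} (x+n)⁻² = π²/sin²(πx)`

The classical Mittag-Leffler expansion of `π²/sin²(πx)` on the real line (Ahlfors, *Complex
Analysis*, Ch. 5 §2.1, display (9): `π²/sin²πz = Σ_{n=-∞}^{∞} 1/(z-n)²`), in the three forms

* `Literature.Analysis.SpecialFunctions.hasSum_inv_sub_sq_add_inv_add_sq` —
  `Σ_{n≥0} (1/(x-(n+1))² + 1/(x+(n+1))²) = π²/sin²(πx) - 1/x²` for real `x ∉ ℤ`;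
* `Literature.Analysis.SpecialFunctions.hasSum_int_inv_add_sq` —
  `Σ_{n∈ℤ} 1/(x+n)² = π²/sin²(πx)` for real `x ∉ ℤ`;
* `Literature.Analysis.SpecialFunctions.hasSum_int_inv_sub_two_pi_mul_sq` —
  `Σ_{n∈ℤ} 1/(x-2πn)² = ¼ sin⁻²(x/2)` for real `x ∉ 2πℤ`, the form used in the finite-range
  decomposition of the lattice Green function (Bauerschmidt–Brydges–Slade, *Introduction to a
  renormalisation group method*, Ch. 3, "Finite-range decomposition: lattice", the proof of the
  first lemma: "Its development into partial fractions is (see e.g. [Ahlf78])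
  `¼ sin⁻²(½x) = Σ_{n∈ℤ} (x-2πn)⁻²`").

## Proof

Mathlib proves the cotangent expansion `π cot(πz) - 1/z = Σ_{n≥0} (1/(z-(n+1)) + 1/(z+(n+1)))`
on `ℂ ∖ ℤ` (`cot_series_rep'`) and its derivatives on the upper half-plane only. We transfer the
expansion to real `x ∉ ℤ` (`hasSum_pi_mul_cot_sub_inv`), and differentiate it term by term in the
real variable on a small interval around `x` avoiding the integers
(`hasDerivAt_tsum_of_isPreconnected`, with the summable majorant `C/(n+1)²`), comparing with the
derivative `-π²/sin²(πx) + 1/x²` of the left-hand side.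

## References

* L. V. Ahlfors, *Complex Analysis*, 3rd ed. (McGraw-Hill, 1979), Ch. 5, §2.1 (partial fractions,
  display (9) for `π²/sin²πz` and (11) for `π cot πz`).
* R. Bauerschmidt, D. C. Brydges, G. Slade, *Introduction to a Renormalisation Group Method*,
  LNM 2242 (Springer, 2019), Ch. 3.
-/

noncomputable section

open Filter Complex Real Metric Set
open scoped Topology

namespace Literature.Analysis.SpecialFunctions

/-! ## The cotangent expansion on the real line -/

/-- A real number which is not an integer lies in `ℂ ∖ ℤ`. [folklore] -/
theorem ofReal_mem_integerComplement {x : ℝ} (hx : ∀ n : ℤ, x ≠ n) :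
    (x : ℂ) ∈ Complex.integerComplement := by
  rw [Complex.mem_integerComplement_iff]
  rintro ⟨n, hn⟩
  have h := congrArg Complex.re hn
  simp only [Complex.intCast_re, Complex.ofReal_re] at h
  exact hx n h.symm

/-- **Partial fractions for the cotangent on the real line**: for real `x ∉ ℤ`,
`π cot(πx) - 1/x = Σ_{n≥0} (1/(x-(n+1)) + 1/(x+(n+1)))` (Mathlib's `cot_series_rep'` at a real
point). [cite: AhlforsCA1979, Ch. 5 §2.1 (11)] -/
theorem hasSum_pi_mul_cot_sub_inv {x : ℝ} (hx : ∀ n : ℤ, x ≠ n) :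
    HasSum (fun n : ℕ => 1 / (x - (n + 1)) + 1 / (x + (n + 1)))
      (π * Real.cot (π * x) - 1 / x) := by
  have hz := ofReal_mem_integerComplement hx
  have h1 : HasSum (fun n : ℕ => cotTerm (x : ℂ) n)
      (π * Complex.cot (π * x) - 1 / x) := by
    rw [cot_series_rep' hz]
    exact (summable_cotTerm hz).hasSum
  have h2 : ∀ n : ℕ, cotTerm (x : ℂ) n =
      ((1 / (x - (n + 1)) + 1 / (x + (n + 1)) : ℝ) : ℂ) := by
    intro n
    simp only [cotTerm]
    push_cast
    rfl
  have hval : (π : ℂ) * Complex.cot (π * x) - 1 / x =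
      ((π * Real.cot (π * x) - 1 / x : ℝ) : ℂ) := by
    push_cast
    rfl
  simp_rw [h2] at h1
  rw [hval] at h1
  exact Complex.hasSum_ofReal.1 h1

/-! ## Distance from a non-integer to the integers -/

/-- For real `x ∉ ℤ` there is `δ > 0` with `|x - m| ≥ δ` for every integer `m` (namely
`min(fract x, 1 - fract x)`); moreover `δ ≤ 1/2`. [folklore] -/
theorem exists_pos_le_abs_sub_int {x : ℝ} (hx : ∀ n : ℤ, x ≠ n) :
    ∃ δ : ℝ, 0 < δ ∧ δ ≤ 1 / 2 ∧ ∀ m : ℤ, δ ≤ |x - m| := by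
  have hf0 : Int.fract x ≠ 0 := by
    intro h
    apply hx ⌊x⌋
    have := Int.self_sub_floor x
    rw [← this] at h
    linarith
  have hf0' : 0 < Int.fract x := lt_of_le_of_ne (Int.fract_nonneg x) (Ne.symm hf0)
  have hf1 : Int.fract x < 1 := Int.fract_lt_one x
  refine ⟨min (Int.fract x) (1 - Int.fract x), lt_min hf0' (by linarith), ?_, fun m => ?_⟩
  · rcases le_total (Int.fract x) (1 / 2) with h | h
    · exact (min_le_left _ _).trans h
    · exact (min_le_right _ _).trans (by linarith)
  · have hfr : Int.fract x = x - ⌊x⌋ := (Int.self_sub_floor x).symm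
    rcases le_or_gt m ⌊x⌋ with hm | hm
    · have hm' : (m : ℝ) ≤ ⌊x⌋ := by exact_mod_cast hm
      calc min (Int.fract x) (1 - Int.fract x) ≤ Int.fract x := min_le_left _ _
        _ ≤ |x - m| := by rw [hfr, abs_of_nonneg (by linarith)]; linarith
    · have hm' : (⌊x⌋ : ℝ) + 1 ≤ m := by exact_mod_cast hm
      have hlt : x < ⌊x⌋ + 1 := Int.lt_floor_add_one x
      calc min (Int.fract x) (1 - Int.fract x) ≤ 1 - Int.fract x := min_le_right _ _
        _ ≤ |x - m| := by rw [hfr, abs_of_nonpos (by linarith)]; linarith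

/-- The majorant: if `|y| ≤ N`, `0 < c`, `|s| = 1` and `δ ≤ |y - sc|` with `δ > 0`, then
`1/(y - sc)² ≤ (4 + 4N²/δ²)/c²` (for `c ≥ 2N` the distance is at least `c/2`, otherwise at least
`δ` while `c < 2N`). [folklore] -/
theorem one_div_sub_sq_le {y c δ N s : ℝ} (hc : 0 < c) (hδ : 0 < δ) (hs : |s| = 1)
    (hyc : δ ≤ |y - s * c|) (hyN : |y| ≤ N) :
    1 / (y - s * c) ^ 2 ≤ (4 + 4 * N ^ 2 / δ ^ 2) / c ^ 2 := by
  have hN : 0 ≤ N := (abs_nonneg y).trans hyN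
  by_cases h : 2 * N ≤ c
  · -- far terms: `|y - sc| ≥ c - |y| ≥ c/2`
    have h1 : c / 2 ≤ |y - s * c| := by
      have h2 : |s * c| - |y| ≤ |s * c - y| := abs_sub_abs_le_abs_sub _ _
      rw [abs_sub_comm] at h2
      rw [abs_mul, hs, one_mul, abs_of_pos hc] at h2
      linarith
    have h3 : (c / 2) ^ 2 ≤ (y - s * c) ^ 2 := by
      rw [← sq_abs (y - s * c)]
      exact pow_le_pow_left₀ (by positivity) h1 2
    calc 1 / (y - s * c) ^ 2 ≤ 1 / (c / 2) ^ 2 := one_div_le_one_div_of_le (by positivity) h3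
      _ = 4 / c ^ 2 := by field_simp; ring
      _ ≤ (4 + 4 * N ^ 2 / δ ^ 2) / c ^ 2 := by
          apply div_le_div_of_nonneg_right _ (by positivity)
          have : 0 ≤ 4 * N ^ 2 / δ ^ 2 := by positivity
          linarith
  · push Not at h
    have h3 : δ ^ 2 ≤ (y - s * c) ^ 2 := by
      rw [← sq_abs (y - s * c)]
      exact pow_le_pow_left₀ hδ.le hyc 2
    have hc2 : c ^ 2 ≤ 4 * N ^ 2 := by nlinarith
    calc 1 / (y - s * c) ^ 2 ≤ 1 / δ ^ 2 := one_div_le_one_div_of_le (by positivity) h3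
      _ ≤ (4 * N ^ 2 / δ ^ 2) / c ^ 2 := by
          rw [div_div, le_div_iff₀ (by positivity)]
          calc 1 / δ ^ 2 * (δ ^ 2 * c ^ 2) = c ^ 2 := by field_simp
            _ ≤ 4 * N ^ 2 := hc2
      _ ≤ (4 + 4 * N ^ 2 / δ ^ 2) / c ^ 2 := by
          apply div_le_div_of_nonneg_right _ (by positivity)
          linarith

/-! ## Derivatives of the partial fractions -/

/-- `d/dz (1/(z-c)) = -1/(y-c)²` at `z = y ≠ c`. [folklore] -/
theorem hasDerivAt_one_div_sub {y c : ℝ} (h : y - c ≠ 0) :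
    HasDerivAt (fun z : ℝ => 1 / (z - c)) (-(1 / (y - c) ^ 2)) y := by
  have h1 := (hasDerivAt_inv h).comp y ((hasDerivAt_id y).sub_const c)
  have e : (fun z : ℝ => 1 / (z - c)) = (fun z : ℝ => z⁻¹) ∘ fun z => id z - c := by
    funext z
    simp [one_div]
  rw [e]
  refine h1.congr_deriv ?_
  simp [one_div]

/-- `d/dz (1/(z+c)) = -1/(y+c)²` at `z = y ≠ -c`. [folklore] -/
theorem hasDerivAt_one_div_add {y c : ℝ} (h : y + c ≠ 0) :
    HasDerivAt (fun z : ℝ => 1 / (z + c)) (-(1 / (y + c) ^ 2)) y := by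
  have h' : y - (-c) ≠ 0 := by rwa [sub_neg_eq_add]
  have h1 := hasDerivAt_one_div_sub h'
  simp only [sub_neg_eq_add] at h1
  exact h1

/-- `d/dz (1/z) = -1/y²` at `z = y ≠ 0`. [folklore] -/
theorem hasDerivAt_one_div {y : ℝ} (h : y ≠ 0) :
    HasDerivAt (fun z : ℝ => 1 / z) (-(1 / y ^ 2)) y := by
  have h1 := hasDerivAt_one_div_sub (c := 0) (by rwa [sub_zero])
  simp only [sub_zero] at h1
  exact h1

/-- `d/dy (cos(πy)/sin(πy)) = -π/sin²(πy)` where `sin(πy) ≠ 0`. [folklore] -/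
theorem hasDerivAt_cos_div_sin_pi_mul {x : ℝ} (hsin : Real.sin (π * x) ≠ 0) :
    HasDerivAt (fun y : ℝ => Real.cos (π * y) / Real.sin (π * y)) (-π / Real.sin (π * x) ^ 2) x := by
  have hc : HasDerivAt (fun y : ℝ => Real.cos (π * y)) (-Real.sin (π * x) * π) x := by
    have := (Real.hasDerivAt_cos (π * x)).comp x ((hasDerivAt_id x).const_mul π)
    simpa only [Function.comp_def, id, mul_one] using this
  have hs : HasDerivAt (fun y : ℝ => Real.sin (π * y)) (Real.cos (π * x) * π) x := by
    have := (Real.hasDerivAt_sin (π * x)).comp x ((hasDerivAt_id x).const_mul π)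
    simpa only [Function.comp_def, id, mul_one] using this
  refine (hc.div hs hsin).congr_deriv ?_
  rw [div_left_inj' (pow_ne_zero 2 hsin)]
  have hsc := Real.sin_sq_add_cos_sq (π * x)
  linear_combination (-π) * hsc

/-! ## Termwise differentiation: the expansion of `π²/sin²(πx)` -/

/-- **Partial fractions for `π²/sin²(πx)` on the real line**: for real `x ∉ ℤ`,
`Σ_{n≥0} (1/(x-(n+1))² + 1/(x+(n+1))²) = π²/sin²(πx) - 1/x²` — the term-by-term derivative of the
cotangent expansion. [cite: AhlforsCA1979, Ch. 5 §2.1 (9)] -/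
theorem hasSum_inv_sub_sq_add_inv_add_sq {x : ℝ} (hx : ∀ n : ℤ, x ≠ n) :
    HasSum (fun n : ℕ => 1 / (x - (n + 1)) ^ 2 + 1 / (x + (n + 1)) ^ 2)
      (π ^ 2 / Real.sin (π * x) ^ 2 - 1 / x ^ 2) := by
  obtain ⟨δ, hδ, hδ2, hδx⟩ := exists_pos_le_abs_sub_int hx
  -- the interval `t = (x - δ/2, x + δ/2)` avoids the integers by `δ/2`
  set t : Set ℝ := ball x (δ / 2) with ht
  have htm : ∀ y ∈ t, ∀ m : ℤ, δ / 2 ≤ |y - m| := by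
    intro y hy m
    rw [ht, mem_ball, Real.dist_eq] at hy
    have h1 := hδx m
    have h2 : |x - m| ≤ |x - y| + |y - m| := abs_sub_le _ _ _
    rw [abs_sub_comm x y] at h2
    linarith
  have htZ : ∀ y ∈ t, ∀ m : ℤ, y ≠ m := by
    intro y hy m h
    have := htm y hy m
    rw [h, sub_self, abs_zero] at this
    linarith
  -- a bound `N` on `|y|`, `y ∈ t`
  obtain ⟨N, hN⟩ : ∃ N : ℕ, |x| + 1 ≤ N := ⟨⌈|x| + 1⌉₊, Nat.le_ceil _⟩
  have hN0 : (0 : ℝ) < N := lt_of_lt_of_le (by positivity) hN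
  have hyN : ∀ y ∈ t, |y| ≤ N := by
    intro y hy
    rw [ht, mem_ball, Real.dist_eq] at hy
    have : |y| ≤ |y - x| + |x| := by
      have := abs_add_le (y - x) x
      rwa [sub_add_cancel] at this
    linarith
  -- the series, its derivative, and the majorant
  set g : ℕ → ℝ → ℝ := fun n y => 1 / (y - (n + 1)) + 1 / (y + (n + 1)) with hg
  set g' : ℕ → ℝ → ℝ := fun n y => -(1 / (y - (n + 1)) ^ 2 + 1 / (y + (n + 1)) ^ 2) with hg'
  set C : ℝ := 4 + 4 * (N : ℝ) ^ 2 / (δ / 2) ^ 2 with hC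
  have hC0 : 0 ≤ C := by positivity
  set u : ℕ → ℝ := fun n => 2 * C / ((n : ℝ) + 1) ^ 2 with hu
  have hu_sum : Summable u := by
    have h1 : Summable fun n : ℕ => 1 / ((n : ℝ) + 1) ^ 2 := by
      have h := (summable_nat_add_iff 1).2 (Real.summable_one_div_nat_pow.2 one_lt_two)
      refine h.congr fun n => ?_
      push_cast
      ring
    refine (h1.mul_left (2 * C)).congr fun n => ?_
    simp only [hu]
    ring
  have hderiv : ∀ n : ℕ, ∀ y ∈ t, HasDerivAt (g n) (g' n y) y := by
    intro n y hy
    have hc1 : y - ((n : ℝ) + 1) ≠ 0 := by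
      have := htZ y hy (n + 1)
      push_cast at this
      exact sub_ne_zero.2 this
    have hc2 : y + ((n : ℝ) + 1) ≠ 0 := by
      have := htZ y hy (-(n + 1 : ℤ))
      push_cast at this
      intro h
      exact this (by linarith)
    have h12 := (hasDerivAt_one_div_sub hc1).add (hasDerivAt_one_div_add hc2)
    simp only [hg, hg']
    exact h12.congr_deriv (by ring)
  have hbound : ∀ n : ℕ, ∀ y ∈ t, ‖g' n y‖ ≤ u n := by
    intro n y hy
    have hc : (0 : ℝ) < (n : ℝ) + 1 := by positivity
    have hb1 : 1 / (y - ((n : ℝ) + 1)) ^ 2 ≤ C / ((n : ℝ) + 1) ^ 2 := by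
      have h := one_div_sub_sq_le (s := 1) hc (half_pos hδ) (by simp) ?_ (hyN y hy)
      · simpa only [one_mul] using h
      · have := htm y hy (n + 1)
        push_cast at this
        simpa only [one_mul] using this
    have hb2 : 1 / (y + ((n : ℝ) + 1)) ^ 2 ≤ C / ((n : ℝ) + 1) ^ 2 := by
      have h := one_div_sub_sq_le (s := -1) hc (half_pos hδ) (by simp) ?_ (hyN y hy)
      · simpa only [neg_one_mul, sub_neg_eq_add] using h
      · have := htm y hy (-(n + 1 : ℤ))
        push_cast at this
        simpa only [neg_one_mul, sub_neg_eq_add] using this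
    simp only [hg', hu, norm_neg, Real.norm_eq_abs]
    rw [abs_of_nonneg (by positivity)]
    calc 1 / (y - ((n : ℝ) + 1)) ^ 2 + 1 / (y + ((n : ℝ) + 1)) ^ 2
        ≤ C / ((n : ℝ) + 1) ^ 2 + C / ((n : ℝ) + 1) ^ 2 := add_le_add hb1 hb2
      _ = 2 * C / ((n : ℝ) + 1) ^ 2 := by ring
  have hxt : x ∈ t := by
    rw [ht]
    exact mem_ball_self (half_pos hδ)
  have hsum0 : Summable fun n => g n x := (hasSum_pi_mul_cot_sub_inv hx).summable
  -- termwise differentiation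
  have hD : HasDerivAt (fun y => ∑' n, g n y) (∑' n, g' n x) x :=
    hasDerivAt_tsum_of_isPreconnected hu_sum isOpen_ball (convex_ball x (δ / 2)).isPreconnected
      hderiv hbound hxt hsum0 hxt
  -- the sum is `π cot(πy) - 1/y` on `t`
  have hFeq : (fun y => ∑' n, g n y) =ᶠ[𝓝 x]
      fun y => π * (Real.cos (π * y) / Real.sin (π * y)) - 1 / y := by
    filter_upwards [isOpen_ball.mem_nhds hxt] with y hy
    rw [← Real.cot_eq_cos_div_sin]
    exact (hasSum_pi_mul_cot_sub_inv (htZ y hy)).tsum_eq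
  have hD' : HasDerivAt (fun y => π * (Real.cos (π * y) / Real.sin (π * y)) - 1 / y)
      (∑' n, g' n x) x := hD.congr_of_eventuallyEq hFeq.symm
  -- the derivative of the left-hand side computed directly
  have hsin : Real.sin (π * x) ≠ 0 := by
    rw [Real.sin_ne_zero_iff]
    intro m h
    apply hx m
    have hπ : (π : ℝ) ≠ 0 := Real.pi_ne_zero
    have h' : (m : ℝ) * π = x * π := by rw [h, mul_comm]
    exact (mul_right_cancel₀ hπ h').symm
  have hx0 : x ≠ 0 := by
    have := hx 0
    push_cast at this
    exact this
  have hF' : HasDerivAt (fun y => π * (Real.cos (π * y) / Real.sin (π * y)) - 1 / y)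
      (-(π ^ 2 / Real.sin (π * x) ^ 2) + 1 / x ^ 2) x := by
    have h := ((hasDerivAt_cos_div_sin_pi_mul hsin).const_mul π).sub (hasDerivAt_one_div hx0)
    exact h.congr_deriv (by ring)
  -- compare
  have heq : ∑' n, g' n x = -(π ^ 2 / Real.sin (π * x) ^ 2) + 1 / x ^ 2 := hD'.unique hF'
  have hsum' : Summable fun n => g' n x :=
    Summable.of_norm_bounded hu_sum fun n => hbound n x hxt
  have hneg := hsum'.hasSum.neg
  rw [heq] at hneg
  have e1 : (fun n : ℕ => 1 / (x - (n + 1)) ^ 2 + 1 / (x + (n + 1)) ^ 2) = fun n => -g' n x := by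
    funext n
    simp only [hg', neg_neg]
  have e2 : π ^ 2 / Real.sin (π * x) ^ 2 - 1 / x ^ 2 =
      -(-(π ^ 2 / Real.sin (π * x) ^ 2) + 1 / x ^ 2) := by ring
  rw [e1, e2]
  exact hneg

/-- **`Σ_{n∈ℤ} 1/(x+n)² = π²/sin²(πx)`** for real `x ∉ ℤ`.
[cite: AhlforsCA1979, Ch. 5 §2.1 (9)] -/
theorem hasSum_int_inv_add_sq {x : ℝ} (hx : ∀ n : ℤ, x ≠ n) :
    HasSum (fun n : ℤ => 1 / (x + n) ^ 2) (π ^ 2 / Real.sin (π * x) ^ 2) := by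
  have h := hasSum_inv_sub_sq_add_inv_add_sq hx
  have hs1 : Summable fun n : ℕ => 1 / (x - (n + 1)) ^ 2 :=
    Summable.of_nonneg_of_le (fun n => by positivity) (fun n => le_add_of_nonneg_right
      (by positivity)) h.summable
  have hs2 : Summable fun n : ℕ => 1 / (x + (n + 1)) ^ 2 :=
    Summable.of_nonneg_of_le (fun n => by positivity) (fun n => le_add_of_nonneg_left
      (by positivity)) h.summable
  have hAB : (∑' n : ℕ, 1 / (x - (n + 1)) ^ 2) + (∑' n : ℕ, 1 / (x + (n + 1)) ^ 2) =
      π ^ 2 / Real.sin (π * x) ^ 2 - 1 / x ^ 2 :=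
    (hs1.hasSum.add hs2.hasSum).unique h
  set f : ℤ → ℝ := fun m => 1 / (x + (m : ℝ)) ^ 2 with hf
  -- nonnegative indices
  have h2 : HasSum (fun n : ℕ => f ((n + 1 : ℕ) : ℤ)) (∑' n : ℕ, 1 / (x + (n + 1)) ^ 2) := by
    refine hs2.hasSum.congr_fun fun n => ?_
    simp only [hf]
    push_cast
    ring
  have hf₁ := (hasSum_nat_add_iff (f := fun n : ℕ => f (n : ℤ)) 1).1 h2
  have e0 : (∑ i ∈ Finset.range 1, f ((i : ℕ) : ℤ)) = 1 / x ^ 2 := by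
    simp [hf]
  rw [e0] at hf₁
  -- negative indices
  have hf₂ : HasSum (fun n : ℕ => f (-(n + 1 : ℤ))) (∑' n : ℕ, 1 / (x - (n + 1)) ^ 2) := by
    refine hs1.hasSum.congr_fun fun n => ?_
    simp only [hf]
    push_cast
    ring
  have htot := HasSum.of_nat_of_neg_add_one (f := f) hf₁ hf₂
  convert htot using 1
  linarith

/-- **`Σ_{n∈ℤ} 1/(x - 2πn)² = ¼ sin⁻²(x/2)`** for real `x ∉ 2πℤ` — the development into partial
fractions used in the finite-range decomposition of the lattice Green function.
[cite: BauerschmidtBrydgesSlade2019RG, Ch. 3, "Finite-range decomposition: lattice" (partial fractions display in the proof of the first lemma)] [cite: AhlforsCA1979, Ch. 5 §2.1 (9)] -/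
theorem hasSum_int_inv_sub_two_pi_mul_sq {x : ℝ} (hx : ∀ n : ℤ, x ≠ 2 * π * n) :
    HasSum (fun n : ℤ => 1 / (x - 2 * π * n) ^ 2) (1 / (4 * Real.sin (x / 2) ^ 2)) := by
  have hπ : (0 : ℝ) < 2 * π := by positivity
  have hu : ∀ n : ℤ, x / (2 * π) ≠ n := by
    intro n h
    apply hx n
    field_simp at h
    linarith
  have h := hasSum_int_inv_add_sq hu
  -- reindex `n ↦ -n` and rescale
  have h2 : HasSum (fun n : ℤ => 1 / (x / (2 * π) - n) ^ 2) (π ^ 2 / Real.sin (π * (x / (2 * π))) ^ 2) := by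
    have := ((Equiv.neg ℤ).hasSum_iff (f := fun n : ℤ => 1 / (x / (2 * π) + n) ^ 2)).2 h
    refine this.congr_fun fun n => ?_
    simp only [Function.comp_apply, Equiv.neg_apply, Int.cast_neg, sub_eq_add_neg]
  have h3 := h2.mul_left (1 / (2 * π) ^ 2)
  have hval : 1 / (2 * π) ^ 2 * (π ^ 2 / Real.sin (π * (x / (2 * π))) ^ 2) =
      1 / (4 * Real.sin (x / 2) ^ 2) := by
    have e : π * (x / (2 * π)) = x / 2 := by field_simp
    rw [e]
    have hπ0 : (π : ℝ) ≠ 0 := Real.pi_ne_zero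
    field_simp
    ring
  rw [hval] at h3
  refine h3.congr_fun fun n => ?_
  have hπ0 : (π : ℝ) ≠ 0 := Real.pi_ne_zero
  rw [one_div_mul_one_div, ← mul_pow]
  congr 1
  field_simp

end Literature.Analysis.SpecialFunctions
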